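import Mathlib
import Summits.KontsevichZagierPeriods.Zeta5Search.SecondOrderAggregate
import Summits.KontsevichZagierPeriods.Zeta5Search.KSecondDigit
import Summits.KontsevichZagierPeriods.Zeta5Search.KSecondOrderLive
import HarnessLib

/-!
# ζ(5) search — THEOREM A‴ in `𝒦`-form: normalised `𝒦`-digits of the classes and the sub-deep PAIRS (DENOM-LAW D1, prover-d1 gen 19)

HONEST FRAMING: systematic search; no irrationality claim unless certified.  Cell `pub-zeta5`, track «DENOM-LAW» D1, seat
`denom-prover-d1` gen 19 (`HOME/denom-law/prover-d1/ATTEMPT-19.md` §3).  The `𝒦`-row twins of typer g11's `SecondOrderPair` §2 and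
`SecondOrderAggregate` §3, valid from `M ≥ 4` on (the W-form needs `M ≥ 6`: `restW_norm`, `tame_digits_norm`), for `m = −M`:
* `deepK_norm`  — `‖𝒦_x/(−p)^{E+3} − ĝ_x(ĉ_x − pφ_xĉ₂_x)‖ ≤ p⁻²` for `E_x ≤ −4` (`secondDigitK`);
* `subK_norm`   — `‖𝒦_x/(−p)^{m+3} + pĝ_xĉ_x‖ ≤ p⁻²` for a pole class with `E_x = m+1 ≤ −3` (`kDigit_holds`);
* `restK_norm`  — `‖𝒦_x/(−p)^{m+3}‖ ≤ p⁻²` for a class without pole, with one pole, or with `E_x ≥ m+2` (`m ≤ −4`;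
  `singlePoleClassKBound_holds`: EVERY single-pole class has `v(𝒦_x) ≥ 1` — the order-≥3 tame singles that spoil the `W`-form at `M = 4`
  never enter the `𝒦`-form);
* `single_cHat_norm` — a single-pole class with `E ≤ −3` has `‖ĝ_xĉ_x‖ ≤ p⁻¹`; `tame_vHat_norm` — a tame single (`ν ≥ 0`, `E ≤ −1`) has
  `‖ĝ_xv̂_x‖ ≤ p⁻¹` (the `V`-half of `tame_digits_norm`, which holds without `E ≤ −4`);
* `sub_pair_normK` — for a pole class `y` with `E_y = −M+1` under hypothesis H4 of `LawA3`: `‖ĝ_yĉ_y + ĝ_ȳĉ_ȳ − c_yτ_K(T)‖ ≤ p⁻¹` and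
  `‖ĝ_yv̂_y + ĝ_ȳv̂_ȳ − c_yτ_V(T)‖ ≤ p⁻¹` (`c_y = pairCoeff`), `M ≥ 4` even.
`p`-adic bookkeeping of rational numbers; nothing about ζ(5), no γ; records in print UNMOVED.
-/

noncomputable section

open Finset

namespace Summit.KontsevichZagierPeriods.Zeta5Search.SecondOrder

open Summit.KontsevichZagierPeriods.Zeta5Search.WedgeDictionary (pfData)
open Summit.KontsevichZagierPeriods.Zeta5Search.CasoratianValuation (InPolytope)
open Summit.KontsevichZagierPeriods.Zeta5Search.ClusterValuation
open Summit.KontsevichZagierPeriods.Zeta5Search.PadicSeries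
open Summit.KontsevichZagierPeriods.Zeta5Search.CellA (padicNorm_classRho_le_one padicNorm_p)

variable {p : ℕ} [hp : Fact p.Prime]

/-! ## §1 Normalised `𝒦`-digits of one class -/

section Digits

variable (b : ℕ → ℤ) (hb : InPolytope b) (hp5 : 5 ≤ p) (hwin : (b 0 + 2 : ℤ) < (p : ℤ) ^ 2) {x : ℕ} (hx : x < p)
include hb hp5 hwin hx

/-- **Deep `𝒦`** (`E_x ≤ −4`): `‖𝒦_x/(−p)^{E+3} − ĝ_x(ĉ_x − pφ_xĉ₂_x)‖ ≤ p⁻²`. -/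
theorem deepK_norm (hE4 : classExp b p x ≤ -4) :
    padicNorm p (classK b p x / (-(p : ℚ)) ^ (classExp b p x + 3)
      - gHat b p x * (cHat b p x - (p : ℚ) * phiHat b p x * cHat2 b p x)) ≤ (p : ℚ) ^ (-(2 : ℤ)) := by
  have hp' : (-(p : ℚ)) ^ (classExp b p x + 3) ≠ 0 := zpow_ne_zero _ (neg_ne_zero.2 (Nat.cast_ne_zero.2 hp.out.ne_zero))
  have h := secondDigitK b hb hp5 hwin hx hE4
  have e : classK b p x / (-(p : ℚ)) ^ (classExp b p x + 3)
      - gHat b p x * (cHat b p x - (p : ℚ) * phiHat b p x * cHat2 b p x) =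
      (classK b p x - (-(p : ℚ)) ^ (classExp b p x + 3) * gHat b p x * (cHat b p x - (p : ℚ) * phiHat b p x * cHat2 b p x))
        / (-(p : ℚ)) ^ (classExp b p x + 3) := by
    field_simp
  rw [e]
  exact norm_div_neg_p_zpow (by rwa [show classExp b p x + 3 + 2 = classExp b p x + 5 by ring])

/-- **First digit of `𝒦`, normalised at `m + 3` for a pole class of exponent `m + 1 ≤ −3`**: `‖𝒦_x/(−p)^{m+3} + p ĝ_x ĉ_x‖ ≤ p⁻²`. -/
theorem subK_norm (hpole : 1 ≤ classPoleCount b p x) {m : ℤ} (hE : classExp b p x = m + 1) (hm : m ≤ -4) :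
    padicNorm p (classK b p x / (-(p : ℚ)) ^ (m + 3) + (p : ℚ) * gHat b p x * cHat b p x) ≤ (p : ℚ) ^ (-(2 : ℤ)) := by
  have hprime := hp.out
  have hpneg : (-(p : ℚ)) ≠ 0 := neg_ne_zero.2 (Nat.cast_ne_zero.2 hprime.ne_zero)
  have hp0 : (p : ℚ) ≠ 0 := Nat.cast_ne_zero.2 hprime.ne_zero
  obtain ⟨-, -, -, hn⟩ := thmA_data b hb hwin
  obtain ⟨q, hq⟩ := card_pos.1 (show 0 < ((classSet b p x).filter fun s => netExp b s < 0).card from hpole)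
  obtain ⟨hqc, hqneg⟩ := mem_filter.1 hq
  have hxmem : x ∈ classSet b p x := base_mem_classSet b hx hpole
  have hK := padicNorm_le_of_val (p := p) fun hne =>
    kDigit_holds b p x q hb hprime hp5 hwin hx hqc hqneg (by omega) hne
  obtain ⟨hgq1, hgg⟩ := padicNorm_gHat_class b hb hp5 hx hqc hxmem
  have hc1 : padicNorm p (cHat b p x) ≤ 1 := padicNorm_cHat_le_one b hb.1.1 hn (by omega) x
  have hK' : padicNorm p (classK b p x - (-(p : ℚ)) ^ (classExp b p x + 1) * (p : ℚ) ^ 2 * gHat b p x * cHat b p x)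
      ≤ (p : ℚ) ^ (-(classExp b p x + 4)) := by
    have e : classK b p x - (-(p : ℚ)) ^ (classExp b p x + 1) * (p : ℚ) ^ 2 * gHat b p x * cHat b p x =
        (classK b p x - (-(p : ℚ)) ^ (classExp b p x + 1) * (p : ℚ) ^ 2 * gHat b p q * cHat b p x)
          + (-(p : ℚ)) ^ (classExp b p x + 1) * (p : ℚ) ^ 2 * ((gHat b p q - gHat b p x) * cHat b p x) := by ring
    rw [e]
    refine (padicNorm.nonarchimedean (p := p)).trans (max_le hK ?_)
    have h1 : padicNorm p ((-(p : ℚ)) ^ (classExp b p x + 1) * (p : ℚ) ^ 2) ≤ (p : ℚ) ^ (-(classExp b p x + 3)) := by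
      have := padicNorm_mul_le (padicNorm_neg_p_zpow (p := p) (classExp b p x + 1)) (padicNorm_p_sq_le (p := p))
      rwa [show -(classExp b p x + 1) + -(2 : ℤ) = -(classExp b p x + 3) by ring] at this
    have h2 : padicNorm p ((gHat b p q - gHat b p x) * cHat b p x) ≤ (p : ℚ) ^ (-(1 : ℤ)) := by
      rw [padicNorm.mul]
      calc _ ≤ (p : ℚ) ^ (-(1 : ℤ)) * 1 := mul_le_mul hgg hc1 (padicNorm.nonneg _) (zpow_p_nonneg _)
        _ = _ := mul_one _
    have := padicNorm_mul_le h1 h2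
    rwa [show -(classExp b p x + 3) + -(1 : ℤ) = -(classExp b p x + 4) by ring] at this
  have e : classK b p x / (-(p : ℚ)) ^ (m + 3) + (p : ℚ) * gHat b p x * cHat b p x =
      (classK b p x - (-(p : ℚ)) ^ (classExp b p x + 1) * (p : ℚ) ^ 2 * gHat b p x * cHat b p x) / (-(p : ℚ)) ^ (m + 3) := by
    rw [hE, show m + 1 + 1 = m + 2 by ring, eq_div_iff (zpow_ne_zero _ hpneg), add_mul,
      div_mul_cancel₀ _ (zpow_ne_zero _ hpneg)]
    have h4 : (-(p : ℚ)) ^ (m + 2) * (p : ℚ) ^ 2 = (-(p : ℚ)) ^ (m + 3) * (-(p : ℚ)) := by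
      rw [show ((p : ℚ)) ^ 2 = (-(p : ℚ)) ^ (2 : ℤ) by rw [zpow_two]; ring, ← zpow_add₀ hpneg, ← zpow_add_one₀ hpneg,
        show m + 2 + 2 = m + 3 + 1 by ring]
    calc classK b p x + (p : ℚ) * gHat b p x * cHat b p x * (-(p : ℚ)) ^ (m + 3)
        = classK b p x - ((-(p : ℚ)) ^ (m + 3) * (-(p : ℚ))) * gHat b p x * cHat b p x := by ring
      _ = _ := by linear_combination (gHat b p x * cHat b p x) * h4
  rw [e]
  have hexp : -(classExp b p x + 4) = -((m + 3) + 2) := by rw [hE]; ring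
  rw [hexp] at hK'
  exact norm_div_neg_p_zpow hK'

omit hp hp5 hwin hx in
/-- `𝒦_x = 0` for a class without poles. -/
theorem classK_eq_zero_of_noPole (h0 : classPoleCount b p x = 0) : classK b p x = 0 := by
  unfold classK
  refine sum_eq_zero fun q hq => sum_eq_zero fun o ho => ?_
  have hqn : q ≤ (b 0).toNat := le_of_mem_classSet b hq
  have hreg : 0 ≤ netExp b q := by
    by_contra hneg
    have : 0 < classPoleCount b p x := card_pos.2 ⟨q, mem_filter.2 ⟨hq, by omega⟩⟩
    omega
  rw [pfData_eq_zero_of_netExp_nonneg b hb hqn hreg (mem_range.1 ho), zero_mul]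

/-- **The rest, `𝒦`** (`m ≤ −4`): a class without pole, with one pole, or with exponent `≥ m + 2` has `‖𝒦_x/(−p)^{m+3}‖ ≤ p⁻²`. -/
theorem restK_norm {m : ℤ} (hm : m ≤ -4) (hE : 2 ≤ classPoleCount b p x → m + 2 ≤ classExp b p x) :
    padicNorm p (classK b p x / (-(p : ℚ)) ^ (m + 3)) ≤ (p : ℚ) ^ (-(2 : ℤ)) := by
  have hprime := hp.out
  refine norm_div_neg_p_zpow ?_
  by_cases hK0 : classK b p x = 0
  · rw [hK0, padicNorm.zero]; exact zpow_p_nonneg _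
  rcases Nat.lt_or_ge (classPoleCount b p x) 2 with hlt | h2
  · have h1 : classPoleCount b p x = 1 := by
      rcases Nat.lt_or_ge (classPoleCount b p x) 1 with h0 | h1
      · exact absurd (classK_eq_zero_of_noPole b hb (by omega)) hK0
      · omega
    have hv := singlePoleClassKBound_holds b p x hb hprime hp5 hwin hx h1 hK0
    exact (padicNorm_le_of_val (p := p) fun _ => hv).trans (zpow_le_zpow_right₀ one_le_p (by omega))
  · have hv := multipoleClassKBound_holds b p x hb hprime hp5 hwin hx (by omega) hK0
    have hE' := hE h2
    exact (padicNorm_le_of_val (p := p) fun _ => hv).trans (zpow_le_zpow_right₀ one_le_p (by omega))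

/-- **Single-pole classes carry no `𝒦`-digit**: `‖ĝ_x ĉ_x‖ ≤ p⁻¹` for a single-pole class with `E_x ≤ −3`
(`v(𝒦_x) ≥ 1` by `singlePoleClassKBound_holds`, while U-K pins `𝒦_x ≡ (−p)^{E+3}ĝĉ (mod p^{E+4})`). -/
theorem single_cHat_norm (hone : classPoleCount b p x = 1) (hE3 : classExp b p x ≤ -3) :
    padicNorm p (gHat b p x * cHat b p x) ≤ (p : ℚ) ^ (-(1 : ℤ)) := by
  have hprime := hp.out
  have hp0 : (p : ℚ) ≠ 0 := Nat.cast_ne_zero.2 hprime.ne_zero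
  have h := subK_norm b hb hp5 hwin hx (by omega) (m := classExp b p x - 1) (by ring) (by omega)
  -- `‖𝒦_x/(−p)^{E+2}‖ ≤ p^{-2}` since `v(𝒦_x) ≥ 1` and `E + 2 ≤ −1`
  have hKn : padicNorm p (classK b p x / (-(p : ℚ)) ^ (classExp b p x - 1 + 3)) ≤ (p : ℚ) ^ (-(2 : ℤ)) := by
    refine norm_div_neg_p_zpow ?_
    by_cases hK0 : classK b p x = 0
    · rw [hK0, padicNorm.zero]; exact zpow_p_nonneg _
    have hv := singlePoleClassKBound_holds b p x hb hprime hp5 hwin hx hone hK0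
    exact (padicNorm_le_of_val (p := p) fun _ => hv).trans (zpow_le_zpow_right₀ one_le_p (by omega))
  have hpg : padicNorm p ((p : ℚ) * (gHat b p x * cHat b p x)) ≤ (p : ℚ) ^ (-(2 : ℤ)) := by
    have e : (p : ℚ) * (gHat b p x * cHat b p x) =
        (classK b p x / (-(p : ℚ)) ^ (classExp b p x - 1 + 3) + (p : ℚ) * gHat b p x * cHat b p x)
          - classK b p x / (-(p : ℚ)) ^ (classExp b p x - 1 + 3) := by ring
    rw [e]; exact (padicNorm.sub (p := p)).trans (max_le h hKn)
  rw [padicNorm.mul, padicNorm_p] at hpg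
  calc padicNorm p (gHat b p x * cHat b p x)
      = (p : ℚ) ^ (1 : ℤ) * ((p : ℚ) ^ (-(1 : ℤ)) * padicNorm p (gHat b p x * cHat b p x)) := by
        rw [← mul_assoc, ← zpow_add₀ hp0]; norm_num
    _ ≤ (p : ℚ) ^ (1 : ℤ) * (p : ℚ) ^ (-(2 : ℤ)) := mul_le_mul_of_nonneg_left hpg (zpow_p_nonneg _)
    _ = (p : ℚ) ^ (-(1 : ℤ)) := by rw [← zpow_add₀ hp0]; norm_num

/-- **Tame `V`-digits vanish** (the `V`-half of `tame_digits_norm`, which needs no `E ≤ −4`): a single-pole class with `E_x ≤ −1` and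
`ν_x ≥ 0` has `‖ĝ_x v̂_x‖ ≤ p⁻¹`. -/
theorem tame_vHat_norm (hone : classPoleCount b p x = 1) (hE1 : classExp b p x ≤ -1) (hν : 0 ≤ classNu b p x) :
    padicNorm p (gHat b p x * vHat b p x) ≤ (p : ℚ) ^ (-(1 : ℤ)) := by
  have hp0 : (p : ℚ) ≠ 0 := Nat.cast_ne_zero.2 hp.out.ne_zero
  have hpole : 1 ≤ classPoleCount b p x := by omega
  set E := classExp b p x with hEdef
  have hVint : padicNorm p (classV b p x) ≤ 1 := by
    have := CellD.padicNorm_classV_le_of b hb hp5 hwin hx (v := 0) (fun _ => hν)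
    simpa using this
  have hV := subV_norm b hb hp5 hwin hx hpole (m := E - 1) (by ring)
  have hp1 : (1 : ℚ) ≤ p := one_le_p
  have hVn : padicNorm p (classV b p x / (-(p : ℚ)) ^ (E - 1)) ≤ (p : ℚ) ^ (-(2 : ℤ)) := by
    rw [padicNorm.div, LevelClass.padicNorm_neg_p_zpow, div_le_iff₀ (zpow_pos (by exact_mod_cast hp.out.pos) _), ← zpow_add₀ hp0]
    exact hVint.trans (one_le_zpow₀ hp1 (by omega))
  have hpg : padicNorm p ((p : ℚ) * gHat b p x * vHat b p x) ≤ (p : ℚ) ^ (-(2 : ℤ)) := by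
    have e : (p : ℚ) * gHat b p x * vHat b p x =
        (classV b p x / (-(p : ℚ)) ^ (E - 1) + (p : ℚ) * gHat b p x * vHat b p x) - classV b p x / (-(p : ℚ)) ^ (E - 1) := by ring
    rw [e]; exact (padicNorm.sub (p := p)).trans (max_le hV hVn)
  rw [mul_assoc, padicNorm.mul, padicNorm_p] at hpg
  calc padicNorm p (gHat b p x * vHat b p x)
      = (p : ℚ) ^ (1 : ℤ) * ((p : ℚ) ^ (-(1 : ℤ)) * padicNorm p (gHat b p x * vHat b p x)) := by
        rw [← mul_assoc, ← zpow_add₀ hp0]; norm_num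
    _ ≤ (p : ℚ) ^ (1 : ℤ) * (p : ℚ) ^ (-(2 : ℤ)) := mul_le_mul_of_nonneg_left hpg (zpow_p_nonneg _)
    _ = (p : ℚ) ^ (-(1 : ℤ)) := by rw [← zpow_add₀ hp0]; norm_num

end Digits

/-! ## §2 The orbit of a sub-deep class is `c_y (τ_K, τ_V)(T)` to first order -/

section SubPair

variable (b : ℕ → ℤ) (hb : InPolytope b) (hp5 : 5 ≤ p) (hpn : (p : ℤ) ≤ b 0) (hwin : (b 0 + 2 : ℤ) < (p : ℤ) ^ 2)
  {M : ℕ} (hM : 4 ≤ M) (hMe : Even M) {T : List ℤ} (hT : T.reverse = T)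
  (H4 : ∀ y, y < p → 1 ≤ classPoleCount b p y → classNu b p y = -(M : ℤ) + 1 →
    isRaise T (classTypeList b p y) = true ∨ (¬ (2 : ℤ) ∣ b 0 ∧ CentreIn b p y ∧ classTypeList b p y = T))
include hb hp5 hpn hwin hM hMe hT H4

/-- **The orbit of a sub-deep class is `c_y (τ_K(T), τ_V(T))` to first order** (`M ≥ 4` even): for a pole class `y` of exponent
`−M+1`, `‖ĝ_yĉ_y + ĝ_ȳĉ_ȳ − c_y τ_K(T)‖ ≤ p⁻¹` and `‖ĝ_yv̂_y + ĝ_ȳv̂_ȳ − c_y τ_V(T)‖ ≤ p⁻¹`, `τ_K(T) = 2ĉ₂(T) − Lĉ(T)`. -/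
theorem sub_pair_normK {y : ℕ} (hy : y < p) (hpole : 1 ≤ classPoleCount b p y) (hE : classExp b p y = -(M : ℤ) + 1) :
    padicNorm p (gHat b p y * cHat b p y + gHat b p (conjClass b p y) * cHat b p (conjClass b p y)
        - pairCoeff b p M y * (2 * typeC2 (tTop T) (tList T) - (tTop T : ℚ) * typeC (tTop T) (tList T))) ≤ (p : ℚ) ^ (-(1 : ℤ)) ∧
      padicNorm p (gHat b p y * vHat b p y + gHat b p (conjClass b p y) * vHat b p (conjClass b p y)
        - pairCoeff b p M y * typeTauV (tTop T) (tList T)) ≤ (p : ℚ) ^ (-(1 : ℤ)) := by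
  have h0 : 0 ≤ b 0 := hb.1.1
  have hp0 : 0 < p := hp.out.pos
  have hp2 : p ≠ 2 := by omega
  obtain ⟨-, -, -, hn⟩ := thmA_data b hb hwin
  have hpn' : p ≤ (b 0).toNat := by have := hb.1.1; omega
  have hyn : y ≤ (b 0).toNat := le_b0_of_lt b hpn hy
  have hE3 : classExp b p y ≤ -3 := by omega
  obtain ⟨hL, hL'⟩ := level_bounds' (p := p) b hyn
  set yc := conjClass b p y with hyc
  set tK : ℚ := 2 * typeC2 (tTop T) (tList T) - (tTop T : ℚ) * typeC (tTop T) (tList T) with htK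
  have hyc' : yc < p := conjClass_lt b hp0 y
  have hycn : yc ≤ (b 0).toNat := le_b0_of_lt b hpn hyc'
  have hEc : classExp b p yc = -(M : ℤ) + 1 := by rw [hyc, classExp_conj b h0 hyn]; exact hE
  have hpolec : 1 ≤ classPoleCount b p yc := by rw [hyc, classPoleCount_conj b h0 hyn]; exact hpole
  have hcc : conjClass b p yc = y := conjClass_conjClass b hy hpn'
  -- integrality of the digits
  have hc1 : ∀ z, padicNorm p (cHat b p z) ≤ 1 := fun z => padicNorm_cHat_le_one b h0 hn hp2 z
  have hv1 : ∀ z, padicNorm p (vHat b p z) ≤ 1 := fun z => LevelClass.padicNorm_vHat_le_one b h0 hn hp2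
  -- `ĝ_ȳ ≡ ĝ_y`
  have hgg : padicNorm p (gHat b p yc - gHat b p y) ≤ (p : ℚ) ^ (-(1 : ℤ)) := by
    by_cases hc : CentreIn b p y
    · rw [hyc, (centreIn_iff_conjClass_eq b hpn' hy).1 hc, sub_self, padicNorm.zero]; exact zpow_p_nonneg _
    · have hodd : Odd (classExp b p y) := by
        rw [hE]; obtain ⟨r, hr⟩ := hMe; exact ⟨-(r : ℤ), by omega⟩
      exact gHat_pair_first b hb hp5 hy hL hL' hc hodd
  -- the live identities from either side
  have key : ∀ {z : ℕ} (hz : z < p) (hzp : 1 ≤ classPoleCount b p z) (hzE : classExp b p z = -(M : ℤ) + 1),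
      classNu b p z = -(M : ℤ) + 1 →
      cHat b p z + cHat b p (conjClass b p z) = tK ∧ vHat b p z + vHat b p (conjClass b p z) = typeTauV (tTop T) (tList T) :=
    fun hz hzp hzE hnu =>
      ⟨live_pairK b hb hp5 hpn hwin hT hz hzp (by omega) (H4 _ hz hzp hnu),
       (live_pair b hb hpn hT hz hzp (by omega) (H4 _ hz hzp hnu)).2⟩
  by_cases hlive : classNu b p y = -(M : ℤ) + 1 ∨ classNu b p yc = -(M : ℤ) + 1
  · have hc : pairCoeff b p M y = gHat b p y := by unfold pairCoeff; rw [if_pos hlive]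
    have hpair : cHat b p y + cHat b p yc = tK ∧ vHat b p y + vHat b p yc = typeTauV (tTop T) (tList T) := by
      rcases hlive with h | h
      · exact key hy hpole hE h
      · have := key hyc' hpolec hEc h
        rw [hcc] at this
        exact ⟨by rw [add_comm]; exact this.1, by rw [add_comm]; exact this.2⟩
    rw [hc, ← hpair.1, ← hpair.2]
    have eK : gHat b p y * cHat b p y + gHat b p yc * cHat b p yc - gHat b p y * (cHat b p y + cHat b p yc) =
        (gHat b p yc - gHat b p y) * cHat b p yc := by ring
    have eV : gHat b p y * vHat b p y + gHat b p yc * vHat b p yc - gHat b p y * (vHat b p y + vHat b p yc) =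
        (gHat b p yc - gHat b p y) * vHat b p yc := by ring
    rw [eK, eV, padicNorm.mul, padicNorm.mul]
    exact ⟨by calc _ ≤ (p : ℚ) ^ (-(1 : ℤ)) * 1 := mul_le_mul hgg (hc1 _) (padicNorm.nonneg _) (zpow_p_nonneg _)
               _ = _ := mul_one _,
           by calc _ ≤ (p : ℚ) ^ (-(1 : ℤ)) * 1 := mul_le_mul hgg (hv1 _) (padicNorm.nonneg _) (zpow_p_nonneg _)
               _ = _ := mul_one _⟩
  · -- both tame singles: no digits
    have hc : pairCoeff b p M y = 0 := by unfold pairCoeff; rw [if_neg hlive]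
    push Not at hlive
    obtain ⟨h1, h0y⟩ := tame_of_classNu_ne b (p := p) (x := y) (by rw [hE]; exact hlive.1)
    obtain ⟨h1c, h0c⟩ := tame_of_classNu_ne b (p := p) (x := yc) (by rw [hEc]; exact hlive.2)
    have hKy := single_cHat_norm b hb hp5 hwin hy h1 hE3
    have hKc := single_cHat_norm b hb hp5 hwin hyc' h1c (by omega)
    have hVy := tame_vHat_norm b hb hp5 hwin hy h1 (by omega) h0y
    have hVc := tame_vHat_norm b hb hp5 hwin hyc' h1c (by omega) h0c
    rw [hc, zero_mul, sub_zero, zero_mul, sub_zero]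
    exact ⟨(padicNorm.nonarchimedean (p := p)).trans (max_le hKy hKc),
      (padicNorm.nonarchimedean (p := p)).trans (max_le hVy hVc)⟩

end SubPair

end Summit.KontsevichZagierPeriods.Zeta5Search.SecondOrder

end
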